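import Summits.BirchSwinnertonDyer.BirchSwinnertonDyer.Theorems.GenusKolyvaginAtTwoMinimalTwinBSDTwoIdentityDoorChebotarev
import Summits.BirchSwinnertonDyer.BirchSwinnertonDyer.Theorems.GenusKolyvaginAtTwoK4NegPhantomFrameTraceBit
import Summits.BirchSwinnertonDyer.BirchSwinnertonDyer.Theorems.ByReductionTypeAtTwoRankOneAtTwoBigImageOddLocalOneDoorBottomTranspositionCount
import Summits.BirchSwinnertonDyer.BirchSwinnertonDyer.Theorems.ByReductionTypeAtTwoOrdKatoHalfAtTwoIsoResidueImage
import Summits.BirchSwinnertonDyer.BirchSwinnertonDyer.Theorems.ByReductionTypeAtTwoOrdKatoHalfAtTwoIsoSteinbergSahTwist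
import Literature.NumberTheory.EllipticCurves.HeegnerPointsKolyvaginCebotarevProofs
import Literature.NumberTheory.EllipticCurves.NonvanishingTwistsWaldspurgerOfHoffsteinLuo
import Literature.NumberTheory.EllipticCurves.PAdicGrossZagierConstantTermProofs
import Literature.NumberTheory.EllipticCurves.ModularityVersionApProofs
import HarnessLib

/-!
# Route `ByReductionTypeAtTwo`, crux `RankOneAtTwoBigImageOddLocal` (stmt-BirchSwinnertonDyer-23715), ES-52B support —
# TRANSPOSITION PRIMES SEPARATING TWO CLASSES OF `H¹(ℚ, E[2])` EXIST (Čebotarev, unconditionally)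

Seat `bsd-f1-sign2-es52b` g0 (one-shot prover, cell `bsd-f1-sign2`; SUMMON `wake/SUMMON-bsd-f1-sign2-es52b-20260831T2347Z.md`,
REF2 P-es-52, REF1 §534), `--supports stmt-BirchSwinnertonDyer-23715 --as helper` (closes nothing).  THEOREMS ONLY (no definition,
no named fact, no `sorry`, no instance); standard axioms; UNCONDITIONAL — Čebotarev is the tree theorem
`Literature.NumberTheory.Automorphic.chebotarev_artinRep_holds` (via `absoluteGaloisGroup.frobenius_dense`), the Stickelberger /
cycle-type bridge «`(Δ_W/ℓ) = −1 ⟺ Frob_ℓ` is a transposition on the `2`-division abscissae» is the tree theorem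
`RankOneAtTwoOneDoor.sign_permGal_eq_legendreSym_of_isArithFrobAt` (so the SUMMON's displayed input (ST) is NOT a hypothesis here).
**BSD is NOT proved by this file; ES-52B is not proved by this file; stmt-23715 stays OPEN; nothing is closed.**

This is step (4) of REF1 §534 (γ) for ES-52B `ES52.RealWindowObstructionAtTwo` (workfile
`Cruxes/RankOneAtTwoBigImageOddLocal/RealFlagKummerWindowES52.lean` @eaf649db1fc4): «Chebotarev in `Gal(ℚ(W[2], β, κ(g))/ℚ) ≤ V² ⋊ S₃`
producing transposition primes with prescribed bits for the two INDEPENDENT classes `β, κ(g)`», in the tree's `H¹`-currency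
(`galH1Torsion`, `torsionLocalKer`, `h1Eval`, `permGal`).

* §1 `mem_torsionLocalKer_padic_iff_h1Eval_mul_self_eq_zero` — THE LOCAL CRITERION AT A TRANSPOSITION PRIME: `W/ℚ` elliptic, `ℓ ∤ 2N_W`
  a prime at the place `v`, `γ` an arithmetic Frobenius at some `𝔓₀ ∣ v` acting on `E[2]` as an involution `≠ 1`, `x ∈ H¹(ℚ, E[2])` unramified
  at the primes above `v`: **`x ∈ ker (H¹(ℚ, E[2]) → H¹(ℚ_ℓ, E[2])) ⟺ [x, γ·γ] = 0`** (gk2-p3's criterion `x_v = 0 ⟺ [x, F] ∈ (F − 1)E[2]`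
  at the prime cut out by `ℚ̄ → ℚ̄_v`, gk2-p4's `⟺ [x, F·F] = 0`, conjugation `[x, δγ²δ⁻¹] = δ·[x, γ²]`, `ℚ_v ≃ ℚ_ℓ`; the template is
  gk2-p4 g34's `…K4NegPhantomFrameTraceBit` §4, with the Lawson–Wuthrich class replaced by an arbitrary unramified class).
* §2 ★ `exists_transposition_prime_not_mem_and_mem_torsionLocalKer` — for `ρ̄_{W,2}` onto and `x, y ∈ H¹(ℚ, E[2])` with `x ≠ 0`, `y ≠ 0`,
  `x ≠ y`, and any finite set `B` of rational primes: **a prime `ℓ ∉ B`, `ℓ ∤ 2N_W`, with `(Δ_W/ℓ) = −1` (Frobenius a transposition on `E[2]`),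
  `x_ℓ ≠ 0` and `y_ℓ = 0`.**  Proof: `τ₀ ∈ Γ_ℚ` with `permGal τ₀ = (0 1)` (surjectivity); the two-class key lemma of LINE 23
  (`IdentityDoor.exists_torsionFixing_fix_h1Eval_eq_pair`, `m = 1`) gives `h₀ ∈ Γ_{ℚ(E[2])}` with `[x, τ₀h₀] = x₀` (a point moved by `τ₀`) and
  `[y, τ₀h₀] = 0`; a Frobenius `γ` in the open set `τ₀h₀·𝒩_{x,y}` at a place outside `B ∪ {p ∣ 2N} ∪ T_x ∪ T_y` (`T_x`, `T_y` the finite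
  ramification sets, `exists_finite_forall_mem_unramifiedKer`) acts on `E[2]` as `τ₀`, has `[x, γγ] = x₀ + τ₀x₀ ≠ 0`, `[y, γγ] = 0`; §1 twice;
  `sign(permGal γ) = −1 = (Δ_W/ℓ)`.

References: [MazurRubin2010] Prop. 3.3, Lemma 3.5 (twisting primes via Čebotarev); [GrossLMS1991] §9 Prop. 9.1, 9.6; [McCallumLMS1991] §3 (3),
Cor. 3.2; [Kramer1981] Prop. 3; [DokchitserDokchitserMathZ2012] Thm (1) (`ℚ(E[2]) ⊇ ℚ(√Δ)`); MEMO-es §50 (ES-52B proof sketch).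
-/

set_option linter.dupNamespace false -- tree convention: `Summit.BirchSwinnertonDyer.BirchSwinnertonDyer.Theorems` (summit = sub-problem)
set_option autoImplicit false

noncomputable section

open scoped Classical Pointwise

namespace Summit.BirchSwinnertonDyer.BirchSwinnertonDyer.Theorems.RankOneAtTwoES52B

open WeierstrassCurve NumberField IsDedekindDomain Field
open Literature.NumberTheory.GaloisRepresentations Literature.NumberTheory.EllipticCurves
open Literature.NumberTheory.EllipticCurves.DokchitserDokchitser2012
open Literature.NumberTheory
open Rat.HeightOneSpectrum (primesEquiv)
open Summit.BirchSwinnertonDyer.BirchSwinnertonDyer.Theorems.GenusKolyTwistingPrime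
open Summit.BirchSwinnertonDyer.BirchSwinnertonDyer.Theorems.GenusExact.FrobeniusCriterion (h1Eval_mul_smul)

/-! ## §1 The local criterion at a transposition prime, for an arbitrary unramified class -/

section Criterion

variable (W : WeierstrassCurve ℚ) [W.IsElliptic]

/-- **The strict local condition at a transposition prime is the bit `[x, γ·γ]`.**  `W/ℚ` elliptic; `ℓ ≠ 2` a prime with `ℓ ∤ N_W` at the
place `v`; `γ ∈ Γ_ℚ` an arithmetic Frobenius at some prime `𝔓₀ ∣ v` of `\bar ℤ`, acting on `E[2]` as an involution moving a point (a
transposition of the three `2`-division points); `x ∈ H¹(ℚ, E[2])` unramified at every prime above `v`.  Then `γ·γ ∈ Γ_{ℚ(E[2])}` and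
**`x ∈ ker (H¹(ℚ, E[2]) → H¹(ℚ_ℓ, E[2])) ⟺ [x, γ·γ] = 0`** — the restriction of `x` to the decomposition group is inflated from the procyclic
quotient generated by Frobenius, `H¹(⟨F⟩, V) = V/(F − 1)V`, and for a transposition `F` on `V = E[2]`: `c(F) ∈ (F − 1)V ⟺ (1 + F)c(F) = 0 ⟺ c(F²) = 0`.
Proof = gk2-p4 g34's transport (`…K4NegPhantomFrameTraceBit` §4) for an arbitrary unramified class: conjugate `γ` to the prime cut out by
`ℚ̄ → ℚ̄_v` (`exists_isArithFrobAt_conj_of_mem_primesAbove_holds`), gk2-p3's `mem_torsionLocalKer_iff_exists_h1Eval_eq_smul_sub`, gk2-p4's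
`exists_h1Eval_eq_smul_sub_iff_h1Eval_mul_self_eq_zero`, `h1Eval_conj`, and `ℚ_v ≃ ℚ_ℓ` (`mem_torsionLocalKer_padic_iff`).
[cite: GrossLMS1991, §9 Prop. 9.6] [cite: McCallumLMS1991, §3 (3)] [cite: SilvermanAEC2009, Prop. VII.4.1] -/
theorem mem_torsionLocalKer_padic_iff_h1Eval_mul_self_eq_zero
    {x : galH1Torsion W (2 : ℤ)} {ℓ : ℕ} [Fact ℓ.Prime] (hℓ2 : ℓ ≠ 2) (hℓN : ¬ ℓ ∣ W.conductorNorm ℤ)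
    {v : HeightOneSpectrum (𝓞 ℚ)} (hℓv : (ℓ : 𝓞 ℚ) ∈ v.asIdeal)
    (hxur : ∀ 𝔓 ∈ v.primesAbove, x ∈ unramifiedKer (geomTorsion W (2 : ℤ)) 𝔓)
    {𝔓₀ : Ideal (absIntegers (𝓞 ℚ) ℚ)} (h𝔓₀ : 𝔓₀ ∈ v.primesAbove) {γ : absoluteGaloisGroup ℚ}
    (hγ : IsArithFrobAt (𝓞 ℚ) γ 𝔓₀)
    (hinv : ∀ T : geomTorsion W (2 : ℤ), γ • γ • T = T) (hγT : ∃ T : geomTorsion W (2 : ℤ), γ • T ≠ T) :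
    x ∈ W.torsionLocalKer ℚ_[ℓ] (2 : ℤ) ↔ h1Eval W (2 : ℤ) x (γ * γ) = 0 := by
  classical
  have hℓ : ℓ.Prime := Fact.out
  have hvℓ : ((primesEquiv v : Nat.Primes) : ℕ) = ℓ := primesEquiv_eq hℓ hℓv
  subst hvℓ
  letI : Algebra ℚ (v.adicCompletion ℚ) := inferInstance
  haveI : CharZero (v.adicCompletion ℚ) := charZero_adicCompletion v
  -- good reduction at `v`, `2 ∉ v`
  have hgood : W.HasGoodReductionAt v :=
    hasGoodReductionAt_of_not_dvd_conductorNorm W v hℓN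
  have hvbad : v ∉ W.badPlaces (𝓞 ℚ) := fun h ↦ h hgood
  have hℓ2' : ¬ ((primesEquiv v : Nat.Primes) : ℕ) ∣ 2 := fun h ↦
    hℓ2 ((Nat.prime_dvd_prime_iff_eq hℓ Nat.prime_two).mp h)
  have h2v : ((2 : ℤ) : 𝓞 ℚ) ∉ v.asIdeal := by
    have h := natCast_not_mem_of_not_dvd hℓ hℓv hℓ2'
    rw [Nat.cast_ofNat] at h
    rw [Int.cast_ofNat]
    exact h
  -- the prime of `\bar ℤ` cut out by `ℚ̄ → ℚ̄_v`, and a Frobenius there (a conjugate of `γ`)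
  obtain ⟨𝔐, h𝔐⟩ := v.localPrimesAbove_nonempty
  set 𝔓w := v.primeBelow (closureEmb (K := ℚ) (v.adicCompletion ℚ)) 𝔐 with h𝔓w_def
  have h𝔓w : 𝔓w ∈ v.primesAbove := v.primeBelow_mem_primesAbove h𝔐
  obtain ⟨δ, -, hF⟩ := HeightOneSpectrum.exists_isArithFrobAt_conj_of_mem_primesAbove_holds h𝔓₀ h𝔓w hγ
  have hFinv : ∀ T : geomTorsion W (2 : ℤ), (δ * γ * δ⁻¹) • (δ * γ * δ⁻¹) • T = T := fun T ↦ by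
    rw [mul_smul, mul_smul, mul_smul, mul_smul, inv_smul_smul, hinv, smul_inv_smul]
  have hFT : ∃ T : geomTorsion W (2 : ℤ), (δ * γ * δ⁻¹) • T ≠ T := by
    obtain ⟨T, hT⟩ := hγT
    refine ⟨δ • T, fun h ↦ hT ?_⟩
    rw [mul_smul, mul_smul, inv_smul_smul] at h
    exact smul_left_cancel δ h
  -- inertia at `v` fixes `E[2]`; `x` is unramified at `𝔓w`
  have hI : 𝔓w.inertia (absoluteGaloisGroup ℚ) ≤ torsionFixing W (2 : ℤ) := inertia_le_torsionFixing W hvbad h2v _ h𝔐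
  have hxur' : x ∈ unramifiedKer (geomTorsion W (2 : ℤ)) 𝔓w := hxur 𝔓w h𝔓w
  -- `γγ` fixes `E[2]`
  have hγγ : γ * γ ∈ torsionFixing W (2 : ℤ) := by
    rw [mem_torsionFixing_iff]
    intro Q
    rw [mul_smul, hinv Q]
  -- `ℚ_ℓ ≃ ℚ_v`, the local criterion at `δγδ⁻¹`, the coboundary/square dictionary, conjugation
  rw [mem_torsionLocalKer_padic_iff W
      (RingEquivClass.toRingEquiv (Rat.HeightOneSpectrum.adicCompletion.padicEquiv (R := 𝓞 ℚ) v)) (2 : ℤ) x,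
    GenusExact.FrobeniusCriterion.mem_torsionLocalKer_iff_exists_h1Eval_eq_smul_sub W (2 : ℤ) h𝔐 hF hI
      (isOpen_torsionFixing W two_ne_zero) (torsionPointsMap_bijective W (v.adicCompletion ℚ) (n := 2) two_ne_zero).2 hxur',
    exists_h1Eval_eq_smul_sub_iff_h1Eval_mul_self_eq_zero W x hFinv hFT,
    show δ * γ * δ⁻¹ * (δ * γ * δ⁻¹) = δ * (γ * γ) * δ⁻¹ by group,
    h1Eval_conj W (2 : ℤ) x δ hγγ, smul_eq_zero_iff_eq]

end Criterion

/-! ## §2 Transposition primes separating two classes (Čebotarev) -/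

section Main

variable (W : WeierstrassCurve ℚ) [W.IsElliptic] [W.IsGloballyMinimal]

/-- ★ **TRANSPOSITION PRIMES SEPARATING TWO CLASSES EXIST (unconditionally).**  `W/ℚ` globally minimal elliptic with `ρ̄_{W,2}` onto
(`Gal(ℚ(E[2])/ℚ) ≅ S₃`); `x, y ∈ H¹(ℚ, E[2])` with `x ≠ 0`, `y ≠ 0`, `x ≠ y`; `B` any finite set of rational primes.  Then there is a prime
`ℓ ∉ B` with `ℓ ∤ 2N_W` and **`(Δ_W/ℓ) = −1`** (an arithmetic Frobenius at `ℓ` permutes the three `2`-division points ODDLY, i.e. as a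
transposition; `jacobiSym W.Δ.num ℓ = −1` in the tree's currency, `Δ = Δ_min ∈ ℤ` on the minimal model) such that
**`x ∉ ker (H¹(ℚ, E[2]) → H¹(ℚ_ℓ, E[2]))` and `y ∈ ker (H¹(ℚ, E[2]) → H¹(ℚ_ℓ, E[2]))`.**
In `Gal(M/ℚ) ≤ E[2]² ⋊ S₃` (`M` the field cut out by `x, y` over `ℚ(E[2])`) this is Čebotarev for the conjugacy class of `(x₀, 0; τ)` with
`τ` a transposition and `x₀ ∉ E[2]^τ`: a `4`-cycle for `x`, an involution for `y`.  Proof: `τ₀` with `permGal τ₀ = (0 1)`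
(`permGal_surjective_of_hasSurjectiveModNGaloisRep_two`); LINE 23's two-class key lemma `exists_torsionFixing_fix_h1Eval_eq_pair` (`m = 1`) gives
`h₀ ∈ Γ_{ℚ(E[2])}` with `[x, h₀] = τ₀(x₀ − [x, τ₀])`, `[y, h₀] = τ₀(−[y, τ₀])`, so `[x, τ₀h₀u] = x₀`, `[y, τ₀h₀u] = 0` for every `u ∈ 𝒩_{x,y}`;
Čebotarev (`frobenius_dense` with the tree's `chebotarev_artinRep_holds`) puts an arithmetic Frobenius `γ` in the open set `τ₀h₀·𝒩_{x,y}` at a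
place `v ∉ {p ∈ B} ∪ {p ∣ 2N_W} ∪ T_x ∪ T_y` (`exists_finite_forall_mem_unramifiedKer`); `γ` acts on `E[2]` as `τ₀`, so `[x, γγ] = x₀ + τ₀x₀ ≠ 0`
and `[y, γγ] = 0`; §1 twice; `sign(permGal γ) = sign(0 1) = −1 = (Δ_W/ℓ)` (`sign_permGal_eq_legendreSym_of_isArithFrobAt`).
[cite: MazurRubin2010, Prop. 3.3 and Lemma 3.5 (twisting primes via Čebotarev)] [cite: GrossLMS1991, §9 Prop. 9.6]
[cite: McCallumLMS1991, §3 Cor. 3.2] [cite: DokchitserDokchitserMathZ2012, Theorem (1), proof] -/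
theorem exists_transposition_prime_not_mem_and_mem_torsionLocalKer (hsurj : W.HasSurjectiveModNGaloisRep 2)
    {x y : galH1Torsion W (2 : ℤ)} (hx : x ≠ 0) (hy : y ≠ 0) (hxy : x ≠ y) (B : Finset ℕ) :
    ∃ ℓ : ℕ, ∃ _ : Fact ℓ.Prime, ℓ ∉ B ∧ ¬ ((ℓ : ℤ) ∣ 2 * (W.conductorNorm ℤ : ℤ)) ∧ jacobiSym W.Δ.num ℓ = -1 ∧
      x ∉ W.torsionLocalKer ℚ_[ℓ] (2 : ℤ) ∧ y ∈ W.torsionLocalKer ℚ_[ℓ] (2 : ℤ) := by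
  classical
  set h2 : (2 : ℚ) ≠ 0 := two_ne_zero with hh2
  -- elementary facts on `E[2]`
  have hV2 : ∀ T : geomTorsion W (2 : ℤ), T + T = 0 := fun T ↦ by
    rw [← two_nsmul]; exact AddSubgroup.torsionBy.nsmul T
  have hneg : ∀ T : geomTorsion W (2 : ℤ), -T = T := fun T ↦ by
    rw [neg_eq_iff_add_eq_zero, hV2]
  -- ### a Galois element acting on `E[2]` as the transposition `(0 1)`
  obtain ⟨τ₀, hτ₀⟩ := SteinbergFibreAtTwo.permGal_surjective_of_hasSurjectiveModNGaloisRep_two W hsurj (Equiv.swap 0 1)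
  have h01 : (0 : Fin 3) ≠ 1 := by decide
  have hsign₀ : Equiv.Perm.sign (permGal W h2 τ₀) = -1 := by rw [hτ₀, Equiv.Perm.sign_swap h01]
  have hinv₀ : ∀ T : geomTorsion W (2 : ℤ), τ₀ • τ₀ • T = T := by
    have h1 : permGal W h2 (τ₀ * τ₀) = 1 := by rw [permGal_mul, hτ₀, Equiv.swap_mul_self]
    intro T
    rw [← mul_smul]
    exact (SteinbergFibreAtTwo.forall_smul_eq_iff_permGal_eq_one W (τ₀ * τ₀)).mpr h1 T
  obtain ⟨x₀, hx₀⟩ : ∃ T : geomTorsion W (2 : ℤ), τ₀ • T ≠ T := by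
    by_contra h
    push Not at h
    have h1 := (SteinbergFibreAtTwo.forall_smul_eq_iff_permGal_eq_one W τ₀).mp h
    rw [h1, Equiv.Perm.sign_one] at hsign₀
    exact absurd hsign₀ (by decide)
  have hsum : x₀ + τ₀ • x₀ ≠ 0 := fun h ↦
    hx₀ ((eq_neg_of_add_eq_zero_right h).trans (hneg x₀))
  -- ### the two-class key lemma: `h₀ ∈ Γ_{ℚ(E[2])}` with prescribed values
  haveI : NeZero (1 : ℕ) := ⟨one_ne_zero⟩
  obtain ⟨h₀, hh₀T, -, hh₀x, hh₀y⟩ :=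
    GenusExact.TwinSwap.IdentityDoor.exists_torsionFixing_fix_h1Eval_eq_pair W hsurj hx hy hxy
      (m := 1) (ζ := (1 : AlgebraicClosure ℚ)) IsPrimitiveRoot.one
      (τ₀ • (x₀ - h1Eval W (2 : ℤ) x τ₀)) (τ₀ • (-h1Eval W (2 : ℤ) y τ₀))
  -- ### the finite exceptional set of places
  obtain ⟨Tx, hTx, hxur⟩ := exists_finite_forall_mem_unramifiedKer W (two_ne_zero : (2 : ℤ) ≠ 0) x
  obtain ⟨Ty, hTy, hyur⟩ := exists_finite_forall_mem_unramifiedKer W (two_ne_zero : (2 : ℤ) ≠ 0) y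
  have hN0 : W.conductorNorm ℤ ≠ 0 := (W.conductorNorm_pos_holds).ne'
  set Bad : Finset ℕ := B ∪ (2 * W.conductorNorm ℤ).primeFactors with hBad
  set S₀ : Set (HeightOneSpectrum (𝓞 ℚ)) := {v | ∃ q ∈ Bad, q.Prime ∧ (q : 𝓞 ℚ) ∈ v.asIdeal} with hS₀
  have hS₀fin : S₀.Finite := by
    have : S₀ ⊆ ⋃ q ∈ (Bad.filter Nat.Prime), {v | (q : 𝓞 ℚ) ∈ v.asIdeal} := by
      intro v ⟨q, hqB, hq, hqv⟩
      simp only [Set.mem_iUnion, Finset.mem_filter]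
      exact ⟨q, ⟨hqB, hq⟩, hqv⟩
    refine Set.Finite.subset (Set.Finite.biUnion (Finset.finite_toSet _) fun q hq ↦ ?_) this
    rw [Finset.coe_filter, Set.mem_setOf_eq] at hq
    have hsub : {v : HeightOneSpectrum (𝓞 ℚ) | (q : 𝓞 ℚ) ∈ v.asIdeal}.Subsingleton :=
      fun v hv v' hv' ↦ HeightOneSpectrum.eq_of_natCast_mem_rat hq.2 hv hv'
    exact hsub.finite
  set S : Set (HeightOneSpectrum (𝓞 ℚ)) := S₀ ∪ Tx ∪ Ty with hS
  have hSfin : S.Finite := (hS₀fin.union hTx).union hTy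
  -- ### Čebotarev: a Frobenius in the open set `τ₀ h₀ · 𝒩_{x,y}`
  set 𝒩 := evalKer W (2 : ℤ) ![x, y] with h𝒩
  have h𝒩open : IsOpen (𝒩 : Set (absoluteGaloisGroup ℚ)) :=
    isOpen_evalKer W _ _ (isOpen_torsionFixing W two_ne_zero)
  set O : Set (absoluteGaloisGroup ℚ) := (fun γ ↦ τ₀ * h₀ * γ) '' (𝒩 : Set _) with hO
  have hOopen : IsOpen O := (Homeomorph.mulLeft (τ₀ * h₀)).isOpenMap _ h𝒩open
  have hOne : O.Nonempty := ⟨τ₀ * h₀ * 1, 1, 𝒩.one_mem, rfl⟩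
  obtain ⟨γ, hγO, v, hvS, 𝔓₀, h𝔓₀, hγ⟩ :=
    (absoluteGaloisGroup.frobenius_dense Automorphic.chebotarev_artinRep_holds ℚ S hSfin
      ).inter_open_nonempty O hOopen hOne
  obtain ⟨u, hu𝒩, rfl⟩ := hγO
  have huT : u ∈ torsionFixing W (2 : ℤ) := hu𝒩.1
  have hux : h1Eval W (2 : ℤ) x u = 0 := hu𝒩.2 0
  have huy : h1Eval W (2 : ℤ) y u = 0 := hu𝒩.2 1
  -- ### the rational prime `ℓ` under `v`
  set ℓ : ℕ := (Rat.HeightOneSpectrum.primesEquiv (R := 𝓞 ℚ) v : ℕ) with hℓdef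
  have hℓ : ℓ.Prime := (Rat.HeightOneSpectrum.primesEquiv (R := 𝓞 ℚ) v).2
  haveI hℓF : Fact ℓ.Prime := ⟨hℓ⟩
  have hℓv : (ℓ : 𝓞 ℚ) ∈ v.asIdeal := by
    have h := (Rat.HeightOneSpectrum.natGenerator_dvd_iff (R := 𝓞 ℚ) v (n := ℓ)).mp dvd_rfl
    rw [Ideal.mem_map_iff_of_surjective _ (Rat.IsIntegralClosure.intEquiv (𝓞 ℚ)).surjective] at h
    obtain ⟨y', hy', hyℓ⟩ := h
    have : y' = (ℓ : 𝓞 ℚ) := (Rat.IsIntegralClosure.intEquiv (𝓞 ℚ)).injective (by rw [hyℓ, map_natCast])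
    rwa [this] at hy'
  have hvS₀ : v ∉ S₀ := fun h ↦ hvS (Or.inl (Or.inl h))
  have hvTx : v ∉ Tx := fun h ↦ hvS (Or.inl (Or.inr h))
  have hvTy : v ∉ Ty := fun h ↦ hvS (Or.inr h)
  have hℓBad : ℓ ∉ Bad := fun h ↦ hvS₀ ⟨ℓ, h, hℓ, hℓv⟩
  simp only [hBad, Finset.mem_union, Nat.mem_primeFactors, not_or] at hℓBad
  obtain ⟨hℓB, hℓ2N'⟩ := hℓBad
  have h2N0 : 2 * W.conductorNorm ℤ ≠ 0 := by positivity
  have hℓ2N : ¬ ℓ ∣ 2 * W.conductorNorm ℤ := fun h ↦ hℓ2N' ⟨hℓ, h, h2N0⟩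
  have hℓ2 : ℓ ≠ 2 := by
    intro h
    apply hℓ2N
    rw [h]
    exact dvd_mul_right 2 _
  have hℓN : ¬ ℓ ∣ W.conductorNorm ℤ := fun h ↦ hℓ2N (dvd_mul_of_dvd_right h 2)
  -- ### the Frobenius `γ = τ₀ h₀ u` acts on `E[2]` as `τ₀`
  have hγact : ∀ T : geomTorsion W (2 : ℤ), (τ₀ * h₀ * u) • T = τ₀ • T := fun T ↦ by
    rw [mul_smul, mul_smul, smul_eq_of_mem_torsionFixing W _ huT, smul_eq_of_mem_torsionFixing W _ hh₀T]
  have hinv : ∀ T : geomTorsion W (2 : ℤ), (τ₀ * h₀ * u) • (τ₀ * h₀ * u) • T = T := fun T ↦ by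
    rw [hγact, hγact, hinv₀]
  have hγT : ∃ T : geomTorsion W (2 : ℤ), (τ₀ * h₀ * u) • T ≠ T := ⟨x₀, by rw [hγact]; exact hx₀⟩
  -- ### the values `[x, γ] = x₀`, `[y, γ] = 0`, `[x, γγ] = x₀ + τ₀x₀ ≠ 0`, `[y, γγ] = 0`
  have hvx : h1Eval W (2 : ℤ) x (τ₀ * h₀ * u) = x₀ := by
    rw [h1Eval_mul_smul, hux, smul_zero, add_zero, h1Eval_mul_smul, hh₀x, hinv₀, add_sub_cancel]
  have hvy : h1Eval W (2 : ℤ) y (τ₀ * h₀ * u) = 0 := by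
    rw [h1Eval_mul_smul, huy, smul_zero, add_zero, h1Eval_mul_smul, hh₀y, hinv₀, add_neg_cancel]
  have hvxx : h1Eval W (2 : ℤ) x (τ₀ * h₀ * u * (τ₀ * h₀ * u)) ≠ 0 := by
    rw [h1Eval_mul_smul, hvx, hγact]
    exact hsum
  have hvyy : h1Eval W (2 : ℤ) y (τ₀ * h₀ * u * (τ₀ * h₀ * u)) = 0 := by
    rw [h1Eval_mul_smul, hvy, smul_zero, add_zero]
  -- ### `(Δ/ℓ) = −1`: `γ` is odd on the letters, and Frobenius acts on `√Δ` by the Legendre symbol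
  have hperm : permGal W h2 (τ₀ * h₀ * u) = permGal W h2 τ₀ := by
    refine Equiv.ext fun i ↦ T_injective W h2 ?_
    rw [T_permGal, T_permGal, hγact]
  have hsignγ : Equiv.Perm.sign (permGal W h2 (τ₀ * h₀ * u)) = -1 := by rw [hperm]; exact hsign₀
  have hgoodℓ : W.HasGoodReductionAtPrime ℓ := by
    by_contra h
    exact hℓN ((W.dvd_conductorNorm_iff_not_hasGoodReductionAtPrime ℓ).mpr h)
  have hnum : W.Δ.num = minimalDiscriminantInt W := by rw [← cast_minimalDiscriminantInt W, Rat.num_intCast]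
  have hΔ : W.Δ = (W.Δ.num : ℚ) := by rw [hnum, cast_minimalDiscriminantInt]
  have hℓΔ : ¬ (ℓ : ℤ) ∣ W.Δ.num := by
    rw [hnum]; exact W.not_dvd_minimalDiscriminantInt_of_hasGoodReductionAtPrime ℓ hgoodℓ
  have hsignQ := RankOneAtTwoOneDoor.sign_permGal_eq_legendreSym_of_isArithFrobAt W hΔ hℓ2 hℓΔ hℓv h𝔓₀ hγ
  have hjac : jacobiSym W.Δ.num ℓ = -1 := by
    rw [← jacobiSym.legendreSym.to_jacobiSym]
    rw [hsignγ] at hsignQ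
    have h' : ((legendreSym ℓ W.Δ.num : ℤ) : ℚ) = ((-1 : ℤ) : ℚ) := by rw [← hsignQ]; norm_num
    exact_mod_cast h'
  -- ### the two local criteria
  have hcritx := mem_torsionLocalKer_padic_iff_h1Eval_mul_self_eq_zero W hℓ2 hℓN hℓv
    (fun 𝔓 h𝔓 ↦ hxur v hvTx 𝔓 h𝔓) h𝔓₀ hγ hinv hγT
  have hcrity := mem_torsionLocalKer_padic_iff_h1Eval_mul_self_eq_zero W hℓ2 hℓN hℓv
    (fun 𝔓 h𝔓 ↦ hyur v hvTy 𝔓 h𝔓) h𝔓₀ hγ hinv hγT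
  refine ⟨ℓ, hℓF, hℓB, fun h ↦ hℓ2N ?_, hjac, fun h ↦ hvxx (hcritx.mp h), hcrity.mpr hvyy⟩
  exact_mod_cast h

end Main

end Summit.BirchSwinnertonDyer.BirchSwinnertonDyer.Theorems.RankOneAtTwoES52B

end
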